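import Summits.ABC.Harvest.StackyNorthcott
import Summits.ABC.ABC.Theorems.SoloBlindPolyABC
import Literature.NumberTheory.DiophantineGeometry.StrongHall
import HarnessLib

/-!
# ABC harvest — GLUE for door C13 «STACKY NORTHCOTT»: both printed arrows of Nasserden–Xiao, in the kernel

`Summits/ABC/Harvest/GlueStacky.lean` — cell `abc-harv`, seat abc-harv-pr-2 (KEY PR-STACKY), namespace
`Summit.ABC.Harvest`. PROOF-ONLY file (no definition, no `sorry`, no axiom, no named fact, no hypothesis beyond
the typed Props): the two arrows printed in B. Nasserden, S. Y. Xiao, Canad. J. Math. 77 (2025) =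
arXiv:2108.04411 for the single stacky curve `𝔛_m = 𝔛(ℙ¹ : (0, ∞, −1), (m, m, m))`, over the Props
`StackyNorthcottWith m κ` / `StackyNorthcott m` and the toolkit of `Summits/ABC/Harvest/StackyNorthcott.lean`,
in the tree's poly-abc currency `Summit.ABC.ABC.Theorems.PolyABC K` («`∃ C > 0, c ≤ C·rad(abc)^K` for all abc
triples») and the summit statement `ABC`.

* §1 `rad(abc)^m ≤ abc · φ_m(a)φ_m(b)φ_m(c)` (positive `a, b, c`; from `rad(u)^m ≤ u φ_m(u)`) and, for an abc
  triple, `φ_m(a)φ_m(b)φ_m(c) ≤ rad(abc)^{m−1}` (NX §6.2 «Trivially `φ_m(u) ≤ rad(u)^{m−1}`» + «`x, y, x+y`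
  pairwise co-prime»).
* §2 (NX §6.2, p. 25 — the converse half of Thm 1.4, for ONE curve) `polyABC_of_stackyNorthcottWith`:
  `4 ≤ m → κm < m − 3 → StackyNorthcottWith m κ → PolyABC ((m−1)/(m−3−κm))` — Northcott at level `1` gives a
  uniform lower bound `ℋ ≥ c₀ > 0` on ALL of `ℙ¹(ℚ)` (minimum over the finite exceptional set, so no exceptional
  triples survive), then `c₀ ≤ rad^{(m−1)/m} · max(a,b)^{3/m−1+κ}` is solved for `max(a,b)`; constant
  `2·c₀^{−m/(m−3−κm)}` (ineffective through `c₀`). Corollary `polyABC_of_stackyNorthcott`: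
  `4 ≤ m → StackyNorthcott m → ∀ M > (m−1)/(m−3), PolyABC M` — the printed «weak variant of the abc-conjecture
  … `rad(abc)^{c_m+ε}`» (§1 p. 4) with **`c_m = (m−1)/(m−3)`** («NOT abc — POLY-ABC(c_m+ε)»; POLY-ABC(M) is
  NOT abc and is not known to give A-PS).
* §3 (NX Thm 2.8, p. 9, specialised to `𝔛_m` — there via Granville 1998 / Belyi; here ELEMENTARY because
  `n·φ_m(n)` is an `m`-th power divisible by every prime of `n`) `stackyNorthcottWith_of_abc`:
  `ABC → 0 < m → 0 < κ → StackyNorthcottWith m κ`: abc at `ε = κ/2` for the signed triple `x + y − (x+y) = 0`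
  (`abc_int_of_abcLe`) plus `rad^m ≤ 2·max³·φφφ` give `log max(|x|,|y|)·κ/2 ≤ log C + (1+κ/2)(log B + log 2)`
  on `{ℋ ≤ B}` (`log_max_le_of_stackyHeight_le`), an explicit box (the stacky points have `|x|, |y| ≤ 1`); and
  the UNCONDITIONAL trivial range `stackyNorthcottWith_of_exponent_pos` (`3/m − 1 + κ > 0`; NX Thm 2.7).
* §4 `stackyNorthcott_of_abc` and **`abc_iff_forall_stackyNorthcott : ABC ↔ ∀ m ≥ 4, StackyNorthcott m`**
  (NX Thm 1.4 restricted to the family `𝔛_m`; (⟸) through `abc_iff_polyABC`, choosing `m > 3 + 2/(K−1)`).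

Census row C13: BOTH printed arrows PROVED (kernel, no named fact); for each fixed `m ≥ 4` the door is
SANDWICHED `abc ⟹ StackyNorthcott m ⟹ POLY-ABC((m−1)/(m−3)+ε)`, and the ladder `∀ m` is a RESTATEMENT of abc.
HONESTY (D-0138/D-0139/D-0140): abc is not proved by any of this — an implication from a sandwiched hypothesis
is a door, not evidence; POLY-ABC(M) is NOT abc; A-PS is NOT abc — «NOT abc — POLY-SZPIRO(E)»; typed ≠ proved.
-/

noncomputable section

open UniqueFactorizationMonoid

namespace Summit.ABC.Harvest

open Literature.NumberTheory.DiophantineGeometry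
open Summit.ABC.ABC.Theorems

/-! ## §1 The two radical inequalities for a triple -/

/-- `rad(abc)^m ≤ a·b·c·(φ_m(a) φ_m(b) φ_m(c))` for positive `a, b, c` (no coprimality needed):
`rad(abc) ≤ rad a · rad b · rad c` and `rad(u)^m ≤ u φ_m(u)`. [folklore] -/
theorem radical_pow_le_mul_stackyPhi₃ {m a b c : ℕ} (hm : 0 < m) (ha : 0 < a) (hb : 0 < b)
    (hc : 0 < c) :
    radical (a * b * c) ^ m ≤ a * b * c * (stackyPhi m a * stackyPhi m b * stackyPhi m c) := by
  have h1 : radical (a * b * c) ≤ radical a * radical b * radical c :=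
    Nat.le_of_dvd (Nat.mul_pos (Nat.mul_pos (Nat.radical_pos _) (Nat.radical_pos _))
      (Nat.radical_pos _)) (radical_mul_dvd.trans (mul_dvd_mul_right radical_mul_dvd _))
  calc radical (a * b * c) ^ m ≤ (radical a * radical b * radical c) ^ m :=
        Nat.pow_le_pow_left h1 m
    _ = radical a ^ m * radical b ^ m * radical c ^ m := by rw [mul_pow, mul_pow]
    _ ≤ (a * stackyPhi m a) * (b * stackyPhi m b) * (c * stackyPhi m c) :=
        Nat.mul_le_mul (Nat.mul_le_mul (StackyPhi.radical_pow_le_mul hm ha)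
          (StackyPhi.radical_pow_le_mul hm hb)) (StackyPhi.radical_pow_le_mul hm hc)
    _ = a * b * c * (stackyPhi m a * stackyPhi m b * stackyPhi m c) := by ring

/-- For an abc triple, `φ_m(a) φ_m(b) φ_m(c) ≤ rad(abc)^{m-1}` (pairwise coprimality makes the
radical multiplicative; Nasserden–Xiao §6.2). [cite: NasserdenXiao2024, §6.2 p. 25] -/
theorem stackyPhi₃_le_radical_pow {m a b c : ℕ} (hm : 0 < m) (h : IsABCTriple a b c) :
    stackyPhi m a * stackyPhi m b * stackyPhi m c ≤ radical (a * b * c) ^ (m - 1) := by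
  obtain ⟨ha, hb, habc, hcop⟩ := h
  have hac : Nat.Coprime a c := by rw [← habc]; exact Nat.coprime_self_add_right.mpr hcop
  have hbc : Nat.Coprime b c := by rw [← habc]; exact Nat.coprime_add_self_right.mpr hcop.symm
  have hab' : IsRelPrime a b := Nat.coprime_iff_isRelPrime.mp hcop
  have habc' : IsRelPrime (a * b) c := Nat.coprime_iff_isRelPrime.mp (Nat.Coprime.mul_left hac hbc)
  rw [radical_mul habc', radical_mul hab', mul_pow, mul_pow]
  have hc : c ≠ 0 := by omega
  exact Nat.mul_le_mul (Nat.mul_le_mul (StackyPhi.le_radical_pow hm ha.ne')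
    (StackyPhi.le_radical_pow hm hb.ne')) (StackyPhi.le_radical_pow hm hc)

/-! ## §2 Northcott on one `𝔛_m` ⟹ polynomial abc (Nasserden–Xiao §6.2) -/

/-- Northcott at level `1` gives a uniform positive lower bound `ℋ ≥ c₀` on all of `ℙ¹(ℚ)`
(the minimum over the finite exceptional set). [folklore] -/
theorem exists_pos_le_stackyHeight {m : ℕ} (hm : 0 < m) {δ : ℝ}
    (h : {p : ℤ × ℤ | IsCoprime p.1 p.2 ∧ stackyHeight m δ p.1 p.2 ≤ 1}.Finite) :
    ∃ c₀ : ℝ, 0 < c₀ ∧ c₀ ≤ 1 ∧ ∀ x y : ℤ, IsCoprime x y → c₀ ≤ stackyHeight m δ x y := by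
  set S := {p : ℤ × ℤ | IsCoprime p.1 p.2 ∧ stackyHeight m δ p.1 p.2 ≤ 1} with hS
  rcases S.eq_empty_or_nonempty with hS0 | hS0
  · refine ⟨1, one_pos, le_rfl, fun x y hxy => ?_⟩
    by_contra hlt
    have hmem : (x, y) ∈ S := ⟨hxy, (not_le.mp hlt).le⟩
    rw [hS0] at hmem
    exact hmem
  · obtain ⟨p₀, hp₀, hmin⟩ :=
      h.toFinset.exists_min_image (fun p => stackyHeight m δ p.1 p.2)
        ((Set.Finite.toFinset_nonempty h).mpr hS0)
    have hp₀S : p₀ ∈ S := (Set.Finite.mem_toFinset h).mp hp₀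
    refine ⟨stackyHeight m δ p₀.1 p₀.2, stackyHeight_pos hm δ hp₀S.1, hp₀S.2, fun x y hxy => ?_⟩
    by_cases hle : stackyHeight m δ x y ≤ 1
    · exact hmin (x, y) ((Set.Finite.mem_toFinset h).mpr ⟨hxy, hle⟩)
    · exact hp₀S.2.trans (not_le.mp hle).le

/-- **Nasserden–Xiao §6.2 for one curve, explicit exponent.** If `H_{-K_{𝔛_m}}·H^κ` has the
Northcott property for some `m ≥ 4` and `0 < κ < (m-3)/m`, then `PolyABC ((m-1)/(m-3-κm))`:
`c ≤ C · rad(abc)^{(m-1)/(m-3-κm)}` for every abc triple. [cite: NasserdenXiao2024, §6.2 p. 25] -/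
theorem polyABC_of_stackyNorthcottWith {m : ℕ} (hm : 4 ≤ m) {κ : ℝ}
    (hκm : κ * m < m - 3) (h : StackyNorthcottWith m κ) :
    PolyABC ((m - 1) / (m - 3 - κ * m)) := by
  have hm0 : 0 < m := by omega
  have hmR : (4 : ℝ) ≤ m := by exact_mod_cast hm
  have hmpos : (0 : ℝ) < m := by linarith
  have hmne : (m : ℝ) ≠ 0 := hmpos.ne'
  set δ : ℝ := 3 / (m : ℝ) - 1 + κ with hδ
  have hδneg : δ < 0 := by
    have hδm : δ * m = 3 - m + κ * m := by rw [hδ]; field_simp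
    by_contra hge; push Not at hge; nlinarith [mul_nonneg hge hmpos.le]
  obtain ⟨c₀, hc₀, hc₀1, hlow⟩ := exists_pos_le_stackyHeight hm0 (h 1)
  set L₀ : ℝ := Real.log c₀ / δ with hL₀
  refine ⟨2 * Real.exp L₀, by positivity, fun a b c habc => ?_⟩
  have htri := habc
  obtain ⟨ha, hb, hab, hcop⟩ := habc
  set P : ℕ := stackyPhi m a * stackyPhi m b * stackyPhi m c with hP
  set X : ℕ := max a b with hX
  have hP0 : 0 < P := Nat.mul_pos (Nat.mul_pos (StackyPhi.pos hm0 _) (StackyPhi.pos hm0 _)) (StackyPhi.pos hm0 _)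
  have hX0 : 0 < X := ha.trans_le (le_max_left a b)
  have hPR : P ≤ radical (a * b * c) ^ (m - 1) := stackyPhi₃_le_radical_pow hm0 htri
  have hR0 : 0 < radical (a * b * c) := Nat.radical_pos _
  have hPpos : (0 : ℝ) < P := by exact_mod_cast hP0
  have hXpos : (0 : ℝ) < X := by exact_mod_cast hX0
  have hRpos : (0 : ℝ) < ((rad a b c : ℕ) : ℝ) := by rw [rad_def]; exact_mod_cast hR0
  set LR : ℝ := Real.log ((rad a b c : ℕ) : ℝ) with hLR
  set LX : ℝ := Real.log (X : ℝ) with hLX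
  set LP : ℝ := Real.log (P : ℝ) with hLP
  -- (i) the Northcott lower bound at `[a : b]`; (ii) `φφφ ≤ rad^{m-1}`; then `LX ≤ L₀ + K·LR`; exponentiate
  have h1 : Real.log c₀ ≤ 1 / m * LP + δ * LX := by
    have hh := hlow a b (Nat.isCoprime_iff_coprime.mpr hcop)
    rw [stackyHeight_natCast, hab] at hh
    have := Real.log_le_log hc₀ hh
    rwa [Real.log_mul (Real.rpow_pos_of_pos hPpos _).ne' (Real.rpow_pos_of_pos hXpos _).ne',
      Real.log_rpow hPpos, Real.log_rpow hXpos] at this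
  have h2 : LP ≤ (m - 1) * LR := by
    have hh : (P : ℝ) ≤ ((rad a b c : ℕ) : ℝ) ^ (m - 1) := by rw [rad_def]; exact_mod_cast hPR
    have := Real.log_le_log hPpos hh
    rw [Real.log_pow] at this
    push_cast [Nat.cast_sub (by omega : 1 ≤ m)] at this
    exact this
  have h3 : Real.log c₀ - (m - 1) / m * LR ≤ LX * δ := by
    have : 1 / (m : ℝ) * LP ≤ (m - 1) / m * LR := by
      rw [div_mul_eq_mul_div, one_mul, div_mul_eq_mul_div]
      exact div_le_div_of_nonneg_right h2 hmpos.le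
    linarith
  have h4 : LX ≤ L₀ + (m - 1) / (m - 3 - κ * m) * LR := by
    have hh := (le_div_iff_of_neg hδneg).mpr h3
    have hden : (m : ℝ) - 3 - κ * m ≠ 0 := by linarith
    have hnum : (3 : ℝ) - m + κ * m ≠ 0 := by linarith
    have hδ' : δ = (3 - m + κ * m) / m := by rw [hδ]; field_simp
    have e : (Real.log c₀ - (m - 1) / m * LR) / δ = L₀ + (m - 1) / (m - 3 - κ * m) * LR := by
      rw [hL₀, hδ', show (m : ℝ) - 3 - κ * m = -(3 - m + κ * m) by ring]
      field_simp
      ring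
    rwa [e] at hh
  calc (c : ℝ) ≤ 2 * X := by exact_mod_cast (show c ≤ 2 * X by omega)
    _ = 2 * Real.exp LX := by rw [hLX, Real.exp_log hXpos]
    _ ≤ 2 * Real.exp (L₀ + (m - 1) / (m - 3 - κ * m) * LR) := by gcongr
    _ = 2 * Real.exp L₀ * ((rad a b c : ℕ) : ℝ) ^ ((m - 1) / (m - 3 - κ * m) : ℝ) := by
        rw [Real.exp_add, Real.rpow_def_of_pos hRpos, hLR, mul_comm (Real.log _), mul_assoc]

/-- **Nasserden–Xiao §6.2 for one curve `𝔛_m` (`m ≥ 4`): Northcott of `H_{-K_{𝔛_m}}·H^κ` for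
every `κ > 0` gives `PolyABC M` for every `M > c_m := (m-1)/(m-3)`** — «NOT abc — POLY-ABC(c_m + ε)».
[cite: NasserdenXiao2024, §1 p. 4 (remark after Thm 1.4) and §6.2 p. 25] -/
theorem polyABC_of_stackyNorthcott {m : ℕ} (hm : 4 ≤ m) (h : StackyNorthcott m) {M : ℝ}
    (hM : ((m : ℝ) - 1) / ((m : ℝ) - 3) < M) : PolyABC M := by
  have hmR : (4 : ℝ) ≤ m := by exact_mod_cast hm
  have hm3 : (0 : ℝ) < m - 3 := by linarith
  have hmpos : (0 : ℝ) < m := by linarith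
  have hM0 : 0 < M := lt_trans (div_pos (by linarith) hm3) hM
  have hM' : (m : ℝ) - 1 < M * (m - 3) := (div_lt_iff₀ hm3).mp hM
  set t : ℝ := (m - 3) - (m - 1) / M with ht
  have ht0 : 0 < t := by rw [ht, sub_pos, div_lt_iff₀ hM0]; linarith
  have htlt : t < m - 3 := by rw [ht]; linarith [div_pos (by linarith : (0 : ℝ) < m - 1) hM0]
  set κ : ℝ := t / (2 * m) with hκ
  have hκ0 : 0 < κ := by positivity
  have hκm' : κ * m = t / 2 := by rw [hκ]; field_simp
  have hκm : κ * m < m - 3 := by rw [hκm']; linarith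
  refine polyABC_mono (polyABC_of_stackyNorthcottWith hm hκm (h κ hκ0)) ?_
  have hden : (m : ℝ) - 3 - κ * m = (m - 1) / M + t / 2 := by rw [hκm', ht]; ring
  have hdenpos : (0 : ℝ) < (m - 1) / M + t / 2 := add_pos (div_pos (by linarith) hM0) (by linarith)
  rw [hden, div_le_iff₀ hdenpos]
  rw [show M * (((m : ℝ) - 1) / M + t / 2) = (m - 1) + M * t / 2 by field_simp]
  nlinarith [mul_pos hM0 ht0]

/-! ## §3 abc ⟹ Northcott of `H_{-K_{𝔛_m}}·H^κ` (Nasserden–Xiao Thm 2.8 on `𝔛_m`); the trivial range -/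

/-- A set of integer pairs with `|x|, |y| ≤ N` throughout is finite. [folklore] -/
theorem finite_of_natAbs_le {S : Set (ℤ × ℤ)} (N : ℕ)
    (h : ∀ p ∈ S, p.1.natAbs ≤ N ∧ p.2.natAbs ≤ N) : S.Finite := by
  refine ((Set.finite_Icc (-(N : ℤ)) N).prod (Set.finite_Icc (-(N : ℤ)) N)).subset ?_
  rintro ⟨x, y⟩ hp
  obtain ⟨hx, hy⟩ := h _ hp
  simp only [Set.mem_prod, Set.mem_Icc]
  have hx' : (x.natAbs : ℤ) ≤ N := by exact_mod_cast hx
  have hy' : (y.natAbs : ℤ) ≤ N := by exact_mod_cast hy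
  rw [Int.natCast_natAbs] at hx' hy'
  exact ⟨abs_le.mp hx', abs_le.mp hy'⟩

/-- **The trivial range** (Nasserden–Xiao Thm 2.7 on `𝔛_m`): if the total exponent `3/m − 1 + κ` is
positive (e.g. `m ≤ 3` and `κ > 0`), `H_{-K_{𝔛_m}}·H^κ` has the Northcott property UNCONDITIONALLY, because
`ℋ^δ(x, y) ≥ max(|x|, |y|)^δ` (`φ_m ≥ 1`). [cite: NasserdenXiao2024, Thm 2.7 p. 9] -/
theorem stackyNorthcottWith_of_exponent_pos {m : ℕ} (hm : 0 < m) {κ : ℝ}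
    (hδ : 0 < 3 / (m : ℝ) - 1 + κ) : StackyNorthcottWith m κ := by
  intro B
  set δ : ℝ := 3 / (m : ℝ) - 1 + κ with hδdef
  set N : ℕ := ⌈B ^ (1 / δ)⌉₊ with hN
  refine finite_of_natAbs_le N ?_
  rintro ⟨x, y⟩ ⟨hxy, hle⟩
  dsimp only at hxy hle ⊢
  set X : ℕ := max x.natAbs y.natAbs with hX
  have hP1 : (1 : ℝ) ≤ ((stackyPhi m x.natAbs * stackyPhi m y.natAbs * stackyPhi m (x + y).natAbs : ℕ) : ℝ) := by
    exact_mod_cast Nat.mul_pos (Nat.mul_pos (StackyPhi.pos hm _) (StackyPhi.pos hm _)) (StackyPhi.pos hm _)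
  have hX0 : (0 : ℝ) ≤ (X : ℝ) := Nat.cast_nonneg _
  have h1 : (X : ℝ) ^ δ ≤ B :=   -- `X^δ ≤ ℋ ≤ B`
    calc (X : ℝ) ^ δ = 1 * (X : ℝ) ^ δ := (one_mul _).symm
      _ ≤ _ := mul_le_mul_of_nonneg_right (Real.one_le_rpow hP1 (by positivity)) (Real.rpow_nonneg hX0 _)
      _ ≤ B := hle
  have h2 : (X : ℝ) ≤ B ^ (1 / δ) :=
    calc (X : ℝ) = ((X : ℝ) ^ δ) ^ (1 / δ) := by rw [one_div, Real.rpow_rpow_inv hX0 hδ.ne']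
      _ ≤ B ^ (1 / δ) := Real.rpow_le_rpow (Real.rpow_nonneg hX0 _) h1 (by positivity)
  have hXN : X ≤ N := by exact_mod_cast (h2.trans (Nat.le_ceil _) : (X : ℝ) ≤ N)
  exact ⟨(le_max_left _ _).trans hXN, (le_max_right _ _).trans hXN⟩

/-- At a degenerate point of `ℙ¹(ℚ)` (one of `x`, `y`, `x + y` vanishes, i.e. one of the three
stacky points `0, ∞, -1`), coprimality forces `|x|, |y| ≤ 1`. [folklore] -/
theorem natAbs_le_one_of_degenerate {x y : ℤ} (hxy : IsCoprime x y)
    (hdeg : x = 0 ∨ y = 0 ∨ x + y = 0) : x.natAbs ≤ 1 ∧ y.natAbs ≤ 1 := by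
  rcases hdeg with rfl | rfl | hs
  · exact ⟨by simp, (Int.isUnit_iff_natAbs_eq.mp (isCoprime_zero_left.mp hxy)).le⟩
  · exact ⟨(Int.isUnit_iff_natAbs_eq.mp (isCoprime_zero_right.mp hxy)).le, by simp⟩
  · have hy : y = -x := by linear_combination hs
    subst hy
    have hx : IsUnit x := isCoprime_self.mp ((IsCoprime.neg_right_iff x x).mp hxy)
    have h1 := (Int.isUnit_iff_natAbs_eq.mp hx).le
    exact ⟨h1, by rwa [Int.natAbs_neg]⟩

/-- **The key estimate behind abc ⟹ Northcott** (logarithmic form). For a non-degenerate point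
`[x : y]` (`x, y, x + y ≠ 0`, coprime) write `a = |x|`, `b = |y|`, `c = |x + y|`, `X = max(a, b)`,
`P = φ_m(a) φ_m(b) φ_m(c)`, `R = rad(abc)`. If `X ≤ C · R^{1+κ/2}` (abc at `ε = κ/2`, for the two
summands) and `ℋ^{3/m-1+κ}_m(x, y) ≤ B`, then `log X · (κ/2) ≤ log C + (1 + κ/2)(log B + log 2)`;
the inputs are `R^m ≤ 2X³P` (`radical_pow_le_mul_stackyPhi₃`) and the two displayed bounds.
[cite: NasserdenXiao2024, Thm 2.8 (§6.1)] -/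
theorem log_max_le_of_stackyHeight_le {m : ℕ} (hm : 0 < m) {κ C B : ℝ} (hκ : 0 < κ) (hC : 1 ≤ C)
    {a b c : ℕ} (ha : 0 < a) (hb : 0 < b) (hc : 0 < c) (hcab : c ≤ a + b)
    (hxa : (a : ℝ) ≤ C * ((radical (a * b * c) : ℕ) : ℝ) ^ (1 + κ / 2))
    (hya : (b : ℝ) ≤ C * ((radical (a * b * c) : ℕ) : ℝ) ^ (1 + κ / 2))
    (hle : ((stackyPhi m a * stackyPhi m b * stackyPhi m c : ℕ) : ℝ) ^ (1 / (m : ℝ))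
        * ((max a b : ℕ) : ℝ) ^ (3 / (m : ℝ) - 1 + κ) ≤ B) :
    Real.log ((max a b : ℕ) : ℝ) * (κ / 2) ≤ Real.log C + (1 + κ / 2) * (Real.log B + Real.log 2) := by
  set P : ℕ := stackyPhi m a * stackyPhi m b * stackyPhi m c with hP
  set X : ℕ := max a b with hX
  set R : ℕ := radical (a * b * c) with hR
  have hP0 : 0 < P := Nat.mul_pos (Nat.mul_pos (StackyPhi.pos hm _) (StackyPhi.pos hm _)) (StackyPhi.pos hm _)
  have hX0 : 0 < X := ha.trans_le (le_max_left a b)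
  have hR0 : 0 < R := Nat.radical_pos _
  -- (A) `R^m ≤ 2 X³ P` in `ℕ`, then in logs; (B) abc in logs; (C) the height bound in logs (`B > 0`)
  have hA0 : R ^ m ≤ 2 * X ^ 3 * P := by
    have h1 := radical_pow_le_mul_stackyPhi₃ hm ha hb hc
    have h2 : a * b * c ≤ 2 * X ^ 3 := by
      have hcX : c ≤ 2 * X := by omega
      calc a * b * c ≤ X * X * (2 * X) :=
            Nat.mul_le_mul (Nat.mul_le_mul (le_max_left a b) (le_max_right a b)) hcX
        _ = 2 * X ^ 3 := by ring
    exact h1.trans (Nat.mul_le_mul_right _ h2)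
  have hmpos : (0 : ℝ) < m := by exact_mod_cast hm
  have hm1 : (1 : ℝ) ≤ m := by exact_mod_cast hm
  have hPpos : (0 : ℝ) < P := by exact_mod_cast hP0
  have hXpos : (0 : ℝ) < X := by exact_mod_cast hX0
  have hRpos : (0 : ℝ) < R := by exact_mod_cast hR0
  have hX1 : (1 : ℝ) ≤ X := by exact_mod_cast hX0
  have hCpos : 0 < C := by linarith
  set LR : ℝ := Real.log (R : ℝ) with hLR
  set LX : ℝ := Real.log (X : ℝ) with hLX
  set LP : ℝ := Real.log (P : ℝ) with hLP
  set LC : ℝ := Real.log C with hLC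
  have hLX0 : 0 ≤ LX := Real.log_nonneg hX1
  have hlog2 : 0 < Real.log 2 := Real.log_pos (by norm_num)
  have hA : (m : ℝ) * LR ≤ Real.log 2 + 3 * LX + LP := by
    have h' : (R : ℝ) ^ m ≤ 2 * (X : ℝ) ^ 3 * P := by exact_mod_cast hA0
    have := Real.log_le_log (by positivity) h'
    rw [Real.log_pow, Real.log_mul (by positivity) hPpos.ne', Real.log_mul (by norm_num) (by positivity),
      Real.log_pow] at this
    push_cast at this
    linarith
  have hB : LX ≤ LC + (1 + κ / 2) * LR := by
    have hXle : (X : ℝ) ≤ C * (R : ℝ) ^ (1 + κ / 2) := by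
      rw [hX, Nat.cast_max]; exact max_le hxa hya
    have := Real.log_le_log hXpos hXle
    rwa [Real.log_mul hCpos.ne' (Real.rpow_pos_of_pos hRpos _).ne', Real.log_rpow hRpos] at this
  have hhpos : 0 < (P : ℝ) ^ (1 / (m : ℝ)) * (X : ℝ) ^ (3 / (m : ℝ) - 1 + κ) :=
    mul_pos (Real.rpow_pos_of_pos hPpos _) (Real.rpow_pos_of_pos hXpos _)
  have hC' : LP + (3 - m + κ * m) * LX ≤ m * Real.log B := by
    have h1 := Real.log_le_log hhpos hle
    rw [Real.log_mul (Real.rpow_pos_of_pos hPpos _).ne' (Real.rpow_pos_of_pos hXpos _).ne',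
      Real.log_rpow hPpos, Real.log_rpow hXpos] at h1
    have h2 := mul_le_mul_of_nonneg_left h1 hmpos.le
    rwa [show (m : ℝ) * (1 / (m : ℝ) * LP + (3 / (m : ℝ) - 1 + κ) * LX) = LP + (3 - m + κ * m) * LX by
      field_simp] at h2
  -- combination (all products supplied)
  have h1κ : (0 : ℝ) ≤ 1 + κ / 2 := by linarith
  have key : (m : ℝ) * (LX * (κ / 2)) ≤ m * (LC + (1 + κ / 2) * (Real.log B + Real.log 2)) := by
    nlinarith [mul_le_mul_of_nonneg_left hA h1κ, mul_le_mul_of_nonneg_left hC' h1κ,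
      mul_le_mul_of_nonneg_left hB hmpos.le, mul_nonneg (mul_nonneg hmpos.le hLX0) (sq_nonneg κ),
      mul_nonneg (sub_nonneg.mpr hm1) (mul_nonneg h1κ hlog2.le),
      mul_nonneg (mul_nonneg hmpos.le hLX0) hκ.le]
  exact le_of_mul_le_mul_left key hmpos

/-- **abc ⟹ Northcott** (Nasserden–Xiao Thm 2.8, specialised to `𝔛_m`; elementary here): under
`ABC`, for every `m ≥ 1` and `κ > 0` the function `H_{-K_{𝔛_m}} · H^κ` has the Northcott
property on `ℙ¹(ℚ)`. Proof: abc at `ε = κ/2` for the signed triple `x + y - (x + y) = 0`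
(`abc_int_of_abcLe`) and `log_max_le_of_stackyHeight_le` put every point of height `≤ B` in an
explicit box. [cite: NasserdenXiao2024, Thm 2.8 (§6.1, p. 25)] -/
theorem stackyNorthcottWith_of_abc (habc : ABC) {m : ℕ} (hm : 0 < m) {κ : ℝ} (hκ : 0 < κ) :
    StackyNorthcottWith m κ := by
  intro B
  have habcLe : ∀ ε : ℝ, 0 < ε → ∃ C : ℝ, ∀ a b c : ℕ, IsABCTriple a b c →
      (c : ℝ) ≤ C * ((rad a b c : ℕ) : ℝ) ^ (1 + ε) := by
    intro ε hε
    obtain ⟨C, -, hC⟩ := (ABC_iff.mp habc) ε hε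
    exact ⟨C, fun a b c h => (hC a b c h).le⟩
  obtain ⟨C, hC1, hC⟩ := abc_int_of_abcLe habcLe (half_pos hκ)
  set E : ℝ := (Real.log C + (1 + κ / 2) * (Real.log B + Real.log 2)) / (κ / 2) with hE
  set N : ℕ := ⌈Real.exp E⌉₊ + 1 with hN
  refine finite_of_natAbs_le N ?_
  rintro ⟨x, y⟩ ⟨hxy, hle⟩
  dsimp only at hxy hle ⊢
  by_cases hdeg : x = 0 ∨ y = 0 ∨ x + y = 0
  · obtain ⟨h1, h2⟩ := natAbs_le_one_of_degenerate hxy hdeg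
    exact ⟨h1.trans (by omega), h2.trans (by omega)⟩
  · push Not at hdeg
    obtain ⟨hx0, hy0, hs0⟩ := hdeg
    obtain ⟨hxa, hya, -⟩ := hC x y (-(x + y)) hx0 hy0 (neg_ne_zero.mpr hs0) hxy (by ring)
    have hprod : (x * y * -(x + y)).natAbs = x.natAbs * y.natAbs * (x + y).natAbs := by
      rw [Int.natAbs_mul, Int.natAbs_mul, Int.natAbs_neg]
    rw [hprod] at hxa hya
    have ha : 0 < x.natAbs := Int.natAbs_pos.mpr hx0
    have hb : 0 < y.natAbs := Int.natAbs_pos.mpr hy0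
    have hc : 0 < (x + y).natAbs := Int.natAbs_pos.mpr hs0
    have hcab : (x + y).natAbs ≤ x.natAbs + y.natAbs := Int.natAbs_add_le x y
    have key := log_max_le_of_stackyHeight_le hm hκ hC1 ha hb hc hcab hxa hya hle
    -- `log X ≤ E`, so `X ≤ exp E ≤ N`
    have hXpos : (0 : ℝ) < ((max x.natAbs y.natAbs : ℕ) : ℝ) := by
      exact_mod_cast ha.trans_le (le_max_left _ _)
    have hLX : Real.log ((max x.natAbs y.natAbs : ℕ) : ℝ) ≤ E :=
      (le_div_iff₀ (by positivity : (0 : ℝ) < κ / 2)).mpr key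
    have hXN : ((max x.natAbs y.natAbs : ℕ) : ℝ) ≤ N := by
      calc ((max x.natAbs y.natAbs : ℕ) : ℝ) = Real.exp (Real.log ((max x.natAbs y.natAbs : ℕ) : ℝ)) :=
            (Real.exp_log hXpos).symm
        _ ≤ Real.exp E := Real.exp_le_exp.mpr hLX
        _ ≤ ⌈Real.exp E⌉₊ := Nat.le_ceil _
        _ ≤ N := by rw [hN]; push_cast; linarith
    have hXN' : max x.natAbs y.natAbs ≤ N := by exact_mod_cast hXN
    exact ⟨(le_max_left _ _).trans hXN', (le_max_right _ _).trans hXN'⟩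

/-! ## §4 The sandwich and Theorem 1.4 on the family `𝔛_m` -/

/-- **abc ⟹ `StackyNorthcott m`** for every `m ≥ 1` (NX Thm 2.8 / the easy half of Thm 1.4 on the
family `𝔛_m`). [cite: NasserdenXiao2024, Thm 2.8] -/
theorem stackyNorthcott_of_abc (habc : ABC) {m : ℕ} (hm : 0 < m) : StackyNorthcott m :=
  fun _κ hκ => stackyNorthcottWith_of_abc habc hm hκ

/-- **Nasserden–Xiao Theorem 1.4 restricted to the family `𝔛_m` (`m ≥ 4`)**: abc holds iff
`H_{-K_{𝔛_m}} · H^κ` is Northcott for every `m ≥ 4` and every `κ > 0`. (⟸): `PolyABC M` for every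
`M > (m-1)/(m-3)`, all `m`, is `PolyABC K` for every `K > 1`, i.e. abc (`abc_iff_polyABC`).
[cite: NasserdenXiao2024, Thm 1.4 and §6.2] -/
theorem abc_iff_forall_stackyNorthcott : ABC ↔ ∀ m : ℕ, 4 ≤ m → StackyNorthcott m := by
  refine ⟨fun h m hm => stackyNorthcott_of_abc h (by omega), fun h => ?_⟩
  rw [abc_iff_polyABC]
  intro K hK
  -- choose `m ≥ 4` with `(m-1)/(m-3) < K`, i.e. `m > 3 + 2/(K-1)`
  obtain ⟨m, hm⟩ := exists_nat_gt (3 + 2 / (K - 1))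
  have hK1 : 0 < K - 1 := by linarith
  have h2 : 0 < 2 / (K - 1) := by positivity
  have hm4 : 4 ≤ m := by
    by_contra hlt
    have : (m : ℝ) ≤ 3 := by exact_mod_cast (by omega : m ≤ 3)
    linarith
  have hm3 : (0 : ℝ) < m - 3 := by linarith [(by exact_mod_cast hm4 : (4 : ℝ) ≤ m)]
  refine polyABC_of_stackyNorthcott hm4 (h m hm4) ?_
  rw [div_lt_iff₀ hm3]
  -- `m - 1 < K (m - 3)` iff `2 < (K-1)(m-3)`, and `(K-1)(m-3) > (K-1)·(2/(K-1)) = 2`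
  have : 2 < (K - 1) * (m - 3) := by
    have h3 : 2 / (K - 1) < m - 3 := by linarith
    have := mul_lt_mul_of_pos_left h3 hK1
    rwa [mul_div_cancel₀ _ hK1.ne'] at this
  linarith

end Summit.ABC.Harvest
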